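import Mathlib
import HarnessLib
import Summits.Parity.GeneralizedHardyLittlewood.Theorems.DilatedChowla.Negative.DilatedChowlaMirrorDefs
import Summits.Parity.GeneralizedHardyLittlewood.Theorems.DilatedChowla.Negative.DilatedChowlaGram

/-!
# `DilatedChowla` (stmt-Parity-13319): the dispersion consequence `DilatedChowla → PowerDispersion`

Line `Sketch` (card `siegel-mirror`), stub `stub_dispersion`.  The crux `LiouvilleMAD.DilatedChowla`
bounds the pencil sums `S c n n' M = Σ_{m ∈ (M,2M]} λ(mn+c) λ(mn'+c)` by `C · M^{1−κ}` uniformly in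
`1 ≤ n ≠ n' ≤ 2M` (notation `S`, `PowerDispersion`, `dilatedChowla_iff`, `S_self_le` from
`DilatedChowlaMirrorDefs`; entries `L z = λ(z.toNat)` from `DilatedTableChowlaBlocks`).

By Linnik's identity (the Gram expansion `sum_sq_sum_eq_gram`)
`Σ_{m ∈ (M,2M]} (Σ_{1 ≤ n ≤ 2M} λ(mn+c))² = Σ_{n,n' ≤ 2M} S c n n' M`;
the `2M` diagonal terms are each `≤ M` (`S_self_le`), the `≤ 4M²` ordered off-diagonal terms are each
`≤ C · M^{1−κ} ≤ max(C,0) · M^{1−κ}` (the crux), and `M² · M^{1−κ} ≤ M^{3−κ}`.  Hence the crux forces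
`Σ_m (Σ_n λ(mn+c))² ≤ 2M² + 4 max(C,0) · M^{3−κ}`: a power-saving Barban–Davenport–Halberstam-type
bound for `λ` in the single class `c mod m` over moduli `m ≍ √x` — a statement on which GRH is silent
(the crux is "beyond GRH at step one").  Elementary bookkeeping; no cited facts.
-/

noncomputable section

namespace Summit.Parity.GeneralizedHardyLittlewood.Theorems.DilatedChowla.Negative

open Summit.Parity.GeneralizedHardyLittlewood.Theorems.DilatedTableChowla.Negative (L)
open Finset

/-- Powers of the scale: `M² · M^{1−κ} ≤ M^{3−κ}` for a natural number `M` (equality for `M ≥ 1`;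
for `M = 0` the left side vanishes and the right side is `0` or `1`). -/
theorem sq_mul_rpow_le_rpow (M : ℕ) (κ : ℝ) :
    (M : ℝ) ^ 2 * (M : ℝ) ^ (1 - κ) ≤ (M : ℝ) ^ (3 - κ) := by
  rcases Nat.eq_zero_or_pos M with rfl | hM
  · calc ((0 : ℕ) : ℝ) ^ 2 * ((0 : ℕ) : ℝ) ^ (1 - κ) = 0 := by
          rw [Nat.cast_zero, sq, zero_mul, zero_mul]
      _ ≤ ((0 : ℕ) : ℝ) ^ (3 - κ) := Real.rpow_nonneg (Nat.cast_nonneg 0) _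
  · have hMpos : (0 : ℝ) < M := Nat.cast_pos.mpr hM
    have h3 : (M : ℝ) ^ (3 - κ) = (M : ℝ) ^ ((2 : ℝ) + (1 - κ)) := by
      congr 1
      ring
    rw [h3, Real.rpow_add hMpos, Real.rpow_two]

/-- Summing an entrywise bound with a diagonal part over the square `Icc 1 (2M) × Icc 1 (2M)`:
if `g n n' ≤ [n = n'] · M + T` for all `1 ≤ n, n' ≤ 2M`, then
`Σ_{n,n' ∈ Icc 1 (2M)} g n n' ≤ 2M² + 4M² · T`. -/
theorem sum_sum_le_of_diag_add {M : ℕ} {T : ℝ} {g : ℕ → ℕ → ℝ}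
    (hg : ∀ n ∈ Icc 1 (2 * M), ∀ n' ∈ Icc 1 (2 * M),
      g n n' ≤ (if n = n' then (M : ℝ) else 0) + T) :
    ∑ n ∈ Icc 1 (2 * M), ∑ n' ∈ Icc 1 (2 * M), g n n'
      ≤ 2 * (M : ℝ) ^ 2 + 4 * (M : ℝ) ^ 2 * T := by
  calc ∑ n ∈ Icc 1 (2 * M), ∑ n' ∈ Icc 1 (2 * M), g n n'
      ≤ ∑ n ∈ Icc 1 (2 * M), ∑ n' ∈ Icc 1 (2 * M), ((if n = n' then (M : ℝ) else 0) + T) :=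
        sum_le_sum fun n hn => sum_le_sum fun n' hn' => hg n hn n' hn'
    _ = ∑ _n ∈ Icc 1 (2 * M), ((M : ℝ) + ((2 * M : ℕ) : ℝ) * T) := by
        refine sum_congr rfl fun n hn => ?_
        rw [sum_add_distrib, sum_ite_eq, if_pos hn, sum_const, Nat.card_Icc, Nat.add_sub_cancel,
          nsmul_eq_mul]
    _ = 2 * (M : ℝ) ^ 2 + 4 * (M : ℝ) ^ 2 * T := by
        rw [sum_const, Nat.card_Icc, Nat.add_sub_cancel, nsmul_eq_mul]
        push_cast
        ring

/-- **The dispersion consequence of the crux.**  `DilatedChowla → PowerDispersion`: for every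
`c ≠ 0`, with the exponent `κ > 0` and constant `C` of the crux at shift `c`,
`Σ_{m ∈ (M,2M]} (Σ_{1 ≤ n ≤ 2M} λ(mn+c))² ≤ 2M² + 4 max(C,0) · M^{3−κ}` for all `M`.
Proof: Linnik's identity `Σ_m (Σ_n λ(mn+c))² = Σ_{n,n'} S c n n' M` (`sum_sq_sum_eq_gram`); the
diagonal `n = n'` contributes `≤ 2M · M` (`S_self_le`), each of the `≤ 4M²` off-diagonal ordered
pairs contributes `≤ |S c n n' M| ≤ C · M^{1−κ}` (the crux, `1 ≤ n ≠ n' ≤ 2M`), and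
`M² · M^{1−κ} ≤ M^{3−κ}`.  This is a power-saving Barban–Davenport–Halberstam-type bound for `λ`
in the single residue class `c mod m` over moduli `m ≍ √x` (`x = 4M²`), beyond what GRH gives. -/
theorem powerDispersion_of_dilatedChowla
    (h : Summit.Parity.GeneralizedHardyLittlewood.Theses.LiouvilleMAD.DilatedChowla) :
    PowerDispersion := by
  intro c hc
  obtain ⟨κ, hκ, C, hS⟩ := dilatedChowla_iff.mp h c hc
  refine ⟨κ, hκ, 4 * max C 0, fun M => ?_⟩
  -- the off-diagonal bound, with a nonnegative constant
  obtain ⟨T, hT⟩ : ∃ T : ℝ, T = max C 0 * (M : ℝ) ^ (1 - κ) := ⟨_, rfl⟩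
  have hrpow0 : (0 : ℝ) ≤ (M : ℝ) ^ (1 - κ) := Real.rpow_nonneg (Nat.cast_nonneg M) _
  have hT0 : 0 ≤ T := hT ▸ mul_nonneg (le_max_right _ _) hrpow0
  -- LINNIK'S IDENTITY (Gram expansion in the dilation variable)
  have hgram : ∑ m ∈ Ioc M (2 * M), (∑ n ∈ Icc 1 (2 * M), L ((m : ℤ) * n + c)) ^ 2
      = ∑ n ∈ Icc 1 (2 * M), ∑ n' ∈ Icc 1 (2 * M), S c n n' M := by
    unfold S
    exact sum_sq_sum_eq_gram (Ioc M (2 * M)) (Icc 1 (2 * M)) (fun m n => L ((m : ℤ) * n + c))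
  -- ENTRYWISE: diagonal `≤ M` (trivial bound), off-diagonal `≤ C · M^{1−κ} ≤ T` (the crux)
  have hentry : ∀ n ∈ Icc 1 (2 * M), ∀ n' ∈ Icc 1 (2 * M),
      S c n n' M ≤ (if n = n' then (M : ℝ) else 0) + T := by
    intro n hn n' hn'
    rw [mem_Icc] at hn hn'
    by_cases hnn' : n = n'
    · subst hnn'
      rw [if_pos rfl]
      linarith [S_self_le c n M]
    · rw [if_neg hnn', zero_add]
      calc S c n n' M ≤ |S c n n' M| := le_abs_self _
        _ ≤ C * (M : ℝ) ^ (1 - κ) := hS M n n' hn.1 hn'.1 hnn' hn.2 hn'.2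
        _ ≤ T := hT ▸ mul_le_mul_of_nonneg_right (le_max_left _ _) hrpow0
  -- SUM and compare powers of `M`
  have h4 : (0 : ℝ) ≤ 4 * max C 0 := mul_nonneg (by norm_num) (le_max_right _ _)
  have hpow := mul_le_mul_of_nonneg_left (sq_mul_rpow_le_rpow M κ) h4
  calc ∑ m ∈ Ioc M (2 * M), (∑ n ∈ Icc 1 (2 * M), L ((m : ℤ) * n + c)) ^ 2
      = ∑ n ∈ Icc 1 (2 * M), ∑ n' ∈ Icc 1 (2 * M), S c n n' M := hgram
    _ ≤ 2 * (M : ℝ) ^ 2 + 4 * (M : ℝ) ^ 2 * T := sum_sum_le_of_diag_add hentry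
    _ = 2 * (M : ℝ) ^ 2 + 4 * max C 0 * ((M : ℝ) ^ 2 * (M : ℝ) ^ (1 - κ)) := by
        rw [hT]
        ring
    _ ≤ 2 * (M : ℝ) ^ 2 + 4 * max C 0 * (M : ℝ) ^ (3 - κ) := by linarith

end Summit.Parity.GeneralizedHardyLittlewood.Theorems.DilatedChowla.Negative

end
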